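import Summits.SmoothPoincare4.SmoothPoincare4.Theses.CommonDualRelay

/-!
# Crux `DualPresentation` (stmt-SmoothPoincare4-15791) — the typed decomposition and its glue (PROVED)

`SpherePresentation → DualUpgrade → WallNormalisation → StabiliseOnce → DualPresentation`
(route items stmt-SmoothPoincare4-18144 / 18145 / 18146 / 18147 → 15791; glue item
`DualPresentationGlue`, stmt-SmoothPoincare4-18148).  Crux-strategist unit
`cstrat-stmt-SmoothPoincare4-15791-r1` (route re-audit 2026-08-17, BC2 redirect of a RESTATED deciding
crux).  This file is the kernel-checked assembly; the same proof, as a `Theorems/` file closing the glue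
item, is attached to stmt-18148 as evidence for a prover to land (Theorems is prover-only, D-0016).

The seams are the parent's own on-paper stages (its docstring): present `M` from `S⁴` by an
algebraically dual middle-level pair (Θ₄ = 0, two-three handlebody, Milnor/Kirby/Matveyev) · upgrade to
framed GEOMETRIC duals on both sides with `C` surgering to `S⁴` (standard pictures + parity) · Wall's
realisation of the transvection `[Cᵢ] ↦ [Aᵢ]` (then Hurewicz) · one `S²×S²` summand for the free pair.
-/

set_option linter.dupNamespace false

namespace Summit.SmoothPoincare4.SmoothPoincare4.Cruxes.DualPresentation

open Summit.SmoothPoincare4.SmoothPoincare4.Theses.CommonDualRelay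

/-- **The decomposition glue, proved**: the four pieces imply `DualPresentation`.  Given the
Statement's `M` and `e : M ≃ₕ S⁴`: present `M` from `S⁴` by an algebraically dual pair `(A, P)` in `N`
(h₁); upgrade to framed geometric duals `G ⊥ A`, `C ⊥ P` with surgery along `C` giving `S⁴` (h₂);
replace `(C, P)` by the Wall-normalised `(C′, P′)` with `Aᵢ ≃ C′ᵢ` (h₃); stabilise once (h₄), whose
conclusion is `DualPresentation`'s verbatim. -/
theorem DualPresentation_of_subs :
    SpherePresentation → DualUpgrade → WallNormalisation → StabiliseOnce → DualPresentation := by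
  intro h₁ h₂ h₃ h₄ M _ _ _ _ _ e
  -- X1: the algebraically dual middle-level presentation of `M` from `S⁴`
  obtain ⟨N, _, _, _, _, _, _, _, oN, oS, oP, k, A, P, hAP, hP, hA⟩ := h₁ M e
  -- X2: framed geometric duals on both sides, `C` surgering to `S⁴`
  obtain ⟨o, G, C, hGA, hCP, hC⟩ := h₂ M e N oN oS oP k A P hAP hP hA
  -- X3: Wall normalisation of the `S⁴`-side pair, `Aᵢ ≃ C′ᵢ`
  obtain ⟨C', P', hCP', hC', hAC'⟩ := h₃ N oN oS oP o k A C P hAP hCP hC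
  -- X4: one stabilisation
  exact h₄ M N oN o k A G C' P' hGA hCP' hAC' hA hC'

/-- The glue ITEM `DualPresentationGlue` (stmt-SmoothPoincare4-18148) holds — it is literally the
implication above. -/
theorem dualPresentationGlue : DualPresentationGlue :=
  DualPresentation_of_subs

end Summit.SmoothPoincare4.SmoothPoincare4.Cruxes.DualPresentation
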